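import Literature.AlgebraicGeometry.HodgeTheory.ComplexOrientationFamily
import Literature.AlgebraicGeometry.HodgeTheory.TopDegreeClasses
import Literature.AlgebraicGeometry.Motives.BettiCycleClassFiniteProofs
import Literature.AlgebraicTopology.SingularHomology.FundamentalClassExistence
import Literature.AlgebraicTopology.SingularHomology.UniversalCoefficientsFree
import Literature.AlgebraicTopology.SingularHomology.ProductKunnethField
import HarnessLib

/-!
# A graded `ℤ`-basis of `H*(X(ℂ); ℤ)` for a smooth projective variety with free integral cohomology

For `X` smooth projective over `ℂ` of dimension `n` whose integral cohomology groups
`Hᵏ(X(ℂ); ℤ)`, `k ≤ 2n`, are FREE (e.g. projective spaces, Grassmannians, curves, K3 surfaces,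
abelian varieties, smooth complete intersections of dimension `≠ 2`… — a hypothesis here), bases of
these finitely generated free groups (`Motives.bettiCohomologyInt_finite_holds`) form a GRADED BASIS
IN THE LERAY–HIRSCH SENSE (Hatcher Thm. 3.16 hypothesis): over the one-point base the comparison map
`(aⱼ) ↦ Σⱼ aⱼ ⌣ vⱼ` is bijective in every degree — the groups above degree `2n` vanish
(`Hᵏ ≅ Hom(Hₖ, ℤ) = 0` by universal coefficients, `Hₖ = 0` and `H₂ₙ ≅ ℤ` free by orientation,
Hatcher Thm. 3.26, Thm. 3.2). This is the fibre input of the integral Künneth theorem for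
`(Y ⊗ X)(ℂ)` (`HodgeTheory/CrossProductsGenericDivisibility`).

* `subsingleton_singularCohomology_int_complexPoints_of_lt` — `Hᵏ(X(ℂ); ℤ) = 0` for `k > 2 dim X`
  (unconditional);
* `exists_gradedBasis_int_complexPoints_of_free` — the graded basis, granted freeness in degrees
  `≤ 2 dim X`.

Everything is proved; no definitions, no named facts.

## References

* A. Hatcher, *Algebraic Topology* (2002), §3.1 Thm. 3.2, §3.2 Thm. 3.16, §3.3 Thm. 3.26, App. A
  Cor. A.9. [HatcherAT2002]
-/

noncomputable section

open Function CategoryTheory Literature.AlgebraicGeometry.Motives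
  Literature.AlgebraicTopology.SingularHomology
  Literature.AlgebraicTopology.SingularHomology.LerayHirsch

namespace Literature.AlgebraicGeometry.HodgeTheory

variable {n : ℕ} {X : SchemeOver ℂ}

/-- The coordinate map of a finite basis is bijective (`r ↦ Σ rᵢ bᵢ` is `b.equivFun.symm`).
[folklore] -/
private theorem bijective_sum_smul_of_basis' (R : Type) [CommRing R] {M : Type} [AddCommGroup M]
    [Module R M] {ι : Type} [Fintype ι] (b : Module.Basis ι R M) :
    Bijective fun r : ι → R ↦ ∑ i, r i • b i := by
  have : (fun r : ι → R ↦ ∑ i, r i • b i) = b.equivFun.symm :=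
    funext fun r ↦ (b.equivFun_symm_apply r).symm
  rw [this]
  exact b.equivFun.symm.bijective

/-- **`Hᵏ(X(ℂ); ℤ) = 0` for `k > 2 dim X`**, `X` smooth projective over `ℂ`: `Hᵏ ≅ Hom(Hₖ, ℤ) = 0`
(universal coefficients: `Hₖ₋₁` is free — zero, or the top homology `H₂ₙ ≅ ℤ` of the closed
connected oriented `2n`-manifold `X(ℂ)`). [cite: HatcherAT2002, §3.1 Thm. 3.2 and §3.3 Thm. 3.26] -/
theorem subsingleton_singularCohomology_int_complexPoints_of_lt (hX : IsSmoothProjective n X)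
    {k : ℕ} (hk : 2 * n < k) : Subsingleton (singularCohomology ℤ ℤ (ComplexPoints X) k) := by
  letI := hX.chartedSpace
  haveI := ComplexPoints.compactSpace_of_isSmoothProjective hX
  haveI := ComplexPoints.t2Space_of_isSmoothProjective hX
  haveI : ConnectedSpace (ComplexPoints X) := connectedSpace_complexPoints hX
  obtain ⟨k, rfl⟩ : ∃ k', k = k' + 1 := ⟨k - 1, by omega⟩
  -- `Hₖ` is free: zero above the dimension, `≅ ℤ` in the top degree
  haveI : Module.Free ℤ (singularHomology ℤ ℤ (ComplexPoints X) k) := by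
    rcases Nat.lt_or_ge (2 * n) k with h | h
    · haveI : Subsingleton (singularHomology ℤ ℤ (ComplexPoints X) k) :=
        ModuleCat.subsingleton_of_isZero (ComplexPoints.isZero_singularHomology_of_lt hX ℤ ℤ h)
      exact Module.Free.of_subsingleton ℤ _
    · obtain rfl : k = 2 * n := by omega
      obtain ⟨i⟩ := nonempty_singularHomology_top_iso_holds (R := ℤ) (X := ComplexPoints X) (2 * n)
        (complexOrientationInt hX)
      exact Module.Free.of_equiv i.toLinearEquiv.symm
  haveI : Subsingleton (singularHomology ℤ ℤ (ComplexPoints X) (k + 1)) :=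
    ModuleCat.subsingleton_of_isZero (ComplexPoints.isZero_singularHomology_of_lt hX ℤ ℤ (by omega))
  exact (kroneckerPairing_bijective_of_free ℤ (ComplexPoints X) k).1.subsingleton

/-- **A graded `ℤ`-basis of `H*(X(ℂ); ℤ)` in the Leray–Hirsch sense, granted freeness**: for `X`
smooth projective over `ℂ` of dimension `n` with `Hᵏ(X(ℂ); ℤ)` free for `k ≤ 2n`, bases of these
finitely generated free groups make the comparison map over the one-point base
`(aⱼ) ↦ Σⱼ aⱼ ⌣ vⱼ : Π_{d j ≤ k} H^{k - d j}(pt; ℤ) → Hᵏ(X(ℂ); ℤ)` bijective for every `k` — the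
fibre hypothesis of the integral Künneth theorem (Hatcher Thm. 3.16).
[cite: HatcherAT2002, §3.2 Thm. 3.16 and App. A Cor. A.9] -/
theorem exists_gradedBasis_int_complexPoints_of_free (hX : IsSmoothProjective n X)
    (hfree : ∀ k : ℕ, k ≤ 2 * n → Module.Free ℤ (singularCohomology ℤ ℤ (ComplexPoints X) k)) :
    ∃ (σ : Fin (2 * n + 1) → Type) (_ : ∀ k, Fintype (σ k))
      (v : (k : Fin (2 * n + 1)) → σ k → singularCohomology ℤ ℤ (ComplexPoints X) k),
      ∀ k, Bijective (lhMap ℤ (fun j : (Σ k, σ k) ↦ (j.1 : ℕ))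
        (ContinuousMap.const (ComplexPoints X) PUnit.unit : C(ComplexPoints X, PUnit.{1}))
        (fun j ↦ v j.1 j.2) k) := by
  classical
  haveI := fun k : Fin (2 * n + 1) ↦ hfree k (by omega)
  haveI := fun k : Fin (2 * n + 1) ↦
    (bettiCohomologyInt_finite_holds hX k : Module.Finite ℤ (singularCohomology ℤ ℤ (ComplexPoints X) k))
  let σ : Fin (2 * n + 1) → Type := fun k ↦
    Module.Free.ChooseBasisIndex ℤ (singularCohomology ℤ ℤ (ComplexPoints X) k)
  let b : (k : Fin (2 * n + 1)) → Module.Basis (σ k) ℤ (singularCohomology ℤ ℤ (ComplexPoints X) k) :=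
    fun k ↦ Module.Free.chooseBasis ℤ _
  haveI : ∀ k, Fintype (σ k) := fun k ↦ inferInstance
  refine ⟨σ, inferInstance, fun k i ↦ b k i, ?_⟩
  exact bijective_lhMap_const_of_basis ℤ (fun k i ↦ b k i)
    (fun k ↦ bijective_sum_smul_of_basis' ℤ (b k))
    (fun k hk ↦ subsingleton_singularCohomology_int_complexPoints_of_lt hX hk)

end Literature.AlgebraicGeometry.HodgeTheory

end
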